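import Literature.NumberTheory.IwasawaTheory.FukudaGroupLayers
import Literature.NumberTheory.IwasawaTheory.FukudaSmallRankAlgebra
import HarnessLib

/-!
# Fukuda's package with a CENTRAL layer: `⁅G, A⁆ ⊆ N_j G_j^p` forces `[G_k : N_k G_k^p] ≤ [G_j : N_j G_j^p]` for every `k`
# (group-theoretic brick of the nilpotency-index form of the one-layer `μ = 0` criterion; proved)

`Proofs`-style file (theorems only: no definition, no named fact, no `sorry`) in topic `NumberTheory/IwasawaTheory`
(namespace `Literature.NumberTheory.IwasawaTheory.FukudaGroup`), written by the literature seat `bsd-potss-conjA-anchor` g20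
(cell `bsd-potss`; serves the asides stmt-BirchSwinnertonDyer-19386 / 19413; closes nothing).  Setting of `FukudaGroupLayers`
(k8t-c4 g20; Washington §13.3 Lemmas 13.15/13.18 in a finite group): `G` finite, `A ⊴ G` abelian of index `p^t` with `G = A⟨g⟩`,
`⟨g⟩ ∩ A = 1`, a family `𝓘` of «inertia» subgroups, `G_j ⊇ A` of index `p^j`, `N_j = ⁅G_j, G_j⁆·⟨I ∩ G_j⟩`, `P_j = G_j^p`; in module
terms (`Additive A`, `φ = conjEnd A g`, `Y₀ = subOf A (⁅G,G⁆ ⊔ ⨆ I)`, `ν_j = ∑_{i<p^j} φ^i`) one has `N_j P_j ∩ A = ν_j Y₀ + pA`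
(`commutator_sup_layer_pow_inf_eq`) and `[G_j : N_j P_j] · #(ν_j Y₀ + pA) = #A` (`relIndex_commutator_sup_layer_pow_mul_card`); in the
arithmetic application `[G_j : N_j P_j] = p^{rank_p Cl(K_{n+j})}` (`Fukuda1994Thm1RankPackage.exists_layer_package`).

* `map_conjEnd_sub_one_le_of_commutator_le` — if `⁅G, A⁆ ≤ N_j P_j` (the layer-`j` quotient `G_j/N_jP_j`, i.e. `Cl(K_{n+j})/p` in the
  application, is CENTRALISED by `g`: the Galois group of the layer acts trivially on it), then `(φ - 1)(A) ⊆ ν_j Y₀ + pA`;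
* `relIndex_layer_le_of_commutator_le` — hence, for `1 < p^j - 1`, `[G_k : N_k P_k] ≤ [G_j : N_j P_j]` for EVERY `k ≤ t`
  (through the seat's `FukudaSmallRank.card_quotient_le_of_map_sub_one_pow_le`, nilpotency index `m = 1`).
What remains for the arithmetic door («`Gal(K_{n₀+1}/K_{n₀})` acts trivially on `Cl(K_{n₀+1})/p` ⟹ the `p`-ranks of all layers are
bounded by `rank_p Cl(K_{n₀+1})` ⟹ `μ = 0`») is to export `⁅G, A⁆ ≤ N_j P_j` from the package under that class-group hypothesis
(equivariant Artin reciprocity, tree `hilbertClassField.artinEquiv_mulEquiv_intAut_apply`); not done here.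

References: [Washington1997] §13.3 Lemmas 13.15, 13.18, Prop. 13.22–13.23; [Fukuda1994] Thm. 1 (proof, p. 264); [Lang1990] Ch. 13 §1 Lemma 3.
-/

set_option autoImplicit false

noncomputable section

open Subgroup Finset
open scoped IsMulCommutative commutatorElement

namespace Literature.NumberTheory.IwasawaTheory.FukudaGroup

variable {G : Type*} [Group G] {A : Subgroup G} [A.Normal] [IsMulCommutative A]

omit [A.Normal] in
/-- Membership in `liftSub` (plumbing). [folklore] -/
private theorem mem_liftSub'' {S : Submodule ℤ (Additive A)} {x : G} :
    x ∈ liftSub A S ↔ ∃ y : A, Additive.ofMul y ∈ S ∧ (y : G) = x := by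
  constructor
  · rintro ⟨y, hy, rfl⟩; exact ⟨y, hy, rfl⟩
  · rintro ⟨y, hy, rfl⟩; exact ⟨y, hy, rfl⟩

/-- `(conjEnd A g - 1) x`, read in `G`, is the commutator `⁅g, x⁆ = g x g⁻¹ x⁻¹`. [folklore] -/
private theorem coe_toMul_conjEnd_sub_one (g : G) (x : Additive A) :
    ((Additive.toMul ((conjEnd A g - 1) x) : A) : G) = ⁅g, ((Additive.toMul x : A) : G)⁆ := by
  rw [LinearMap.sub_apply, Module.End.one_apply, toMul_sub, Subgroup.coe_div, commutatorElement_def, div_eq_mul_inv]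
  rfl

variable [Finite G] {p : ℕ} [hp : Fact p.Prime] {g : G} {𝓘 : Set (Subgroup G)} {t : ℕ}

/-- **A centralised layer: `⁅G, A⁆ ⊆ N_j P_j` gives `(φ - 1)(A) ⊆ ν_j Y₀ + pA`.**  (`⁅g, a⁆ ∈ N_jP_j ∩ A = ν_jY₀ + pA` by
`commutator_sup_layer_pow_inf_eq`.) [cite: Washington1997, §13.3 Lemma 13.18] [cite: Fukuda1994, Thm. 1 (2), p. 264 (proof)] -/
theorem map_conjEnd_sub_one_le_of_commutator_le (hgA : Subgroup.zpowers g ⊓ A = ⊥) (hgen : A ⊔ Subgroup.zpowers g = ⊤)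
    (hind : A.index = p ^ t) (h𝓘 : ∀ I ∈ 𝓘, I ⊓ A = ⊥ ∧ (I = ⊥ ∨ I ⊔ A = ⊤)) (hg𝓘 : Subgroup.zpowers g ∈ 𝓘)
    {j : ℕ} (hj : j ≤ t) {Gj : Subgroup G} (hAGj : A ≤ Gj) (hGj : Gj.index = p ^ j)
    (hcent : ⁅(⊤ : Subgroup G), A⁆ ≤
      (⁅Gj, Gj⁆ ⊔ ⨆ I ∈ 𝓘, I ⊓ Gj) ⊔ Subgroup.closure ((fun x : G => x ^ p) '' (Gj : Set G))) :
    (⊤ : Submodule ℤ (Additive A)).map (conjEnd A g - 1) ≤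
      (subOf A (⁅(⊤ : Subgroup G), ⊤⁆ ⊔ ⨆ I ∈ 𝓘, I)).map (∑ i ∈ range (p ^ j), conjEnd A g ^ i) ⊔
        (⊤ : Submodule ℤ (Additive A)).map ((p : ℤ) • (1 : Module.End ℤ (Additive A))) := by
  rintro _ ⟨x, -, rfl⟩
  set a : A := Additive.toMul x with ha
  -- `⁅g, a⁆ ∈ N_j P_j ∩ A`
  have hcomm : ⁅g, (a : G)⁆ ∈ ⁅(⊤ : Subgroup G), A⁆ := Subgroup.commutator_mem_commutator (Subgroup.mem_top g) a.2
  have hA : ⁅g, (a : G)⁆ ∈ A := by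
    rw [commutatorElement_def]
    exact A.mul_mem ((inferInstance : A.Normal).conj_mem _ a.2 g) (A.inv_mem a.2)
  have hmem : ⁅g, (a : G)⁆ ∈ ((⁅Gj, Gj⁆ ⊔ ⨆ I ∈ 𝓘, I ⊓ Gj) ⊔
      Subgroup.closure ((fun x : G => x ^ p) '' (Gj : Set G))) ⊓ A := ⟨hcent hcomm, hA⟩
  rw [commutator_sup_layer_pow_inf_eq hgA hgen hind h𝓘 hg𝓘 hj hAGj hGj, mem_liftSub''] at hmem
  obtain ⟨y, hy, hyeq⟩ := hmem
  have hxy : (conjEnd A g - 1) x = Additive.ofMul y := by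
    apply Additive.toMul.injective
    apply Subtype.ext
    rw [coe_toMul_conjEnd_sub_one, toMul_ofMul, hyeq]
  rw [hxy]
  exact hy

/-- **`[G_k : N_k P_k] ≤ [G_j : N_j P_j]` for every `k`, once layer `j` is centralised and `p^j ≥ 3`** (`1 < p^j - 1`: `p` odd and
`j ≥ 1`, or `p = 2` and `j ≥ 2`).  In the arithmetic application: if `Gal(K_{n+j}/K_n)` acts trivially on `Cl(K_{n+j})/p` then
`rank_p Cl(K_{n+k}) ≤ rank_p Cl(K_{n+j})` for all `k` (nilpotency-index form of the one-layer criterion, `m = 1`).  The hypothesis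
`⁅G, A⁆ ≤ N_jP_j` follows from the centrality `⁅G, G_j⁆ ≤ N_jP_j` of the whole layer quotient (`Subgroup.commutator_mono`, `A ≤ G_j`).
[cite: Washington1997, §13.3 Lemma 13.18 and Prop. 13.22] [cite: Fukuda1994, Thm. 1 (2), p. 264 (proof)] [cite: Lang1990, Ch. 13 §1 Lemma 3] -/
theorem relIndex_layer_le_of_commutator_le (hgA : Subgroup.zpowers g ⊓ A = ⊥) (hgen : A ⊔ Subgroup.zpowers g = ⊤)
    (hind : A.index = p ^ t) (h𝓘 : ∀ I ∈ 𝓘, I ⊓ A = ⊥ ∧ (I = ⊥ ∨ I ⊔ A = ⊤)) (hg𝓘 : Subgroup.zpowers g ∈ 𝓘)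
    {j : ℕ} (hj : j ≤ t) (hpj : 1 < p ^ j - 1) {Gj : Subgroup G} (hAGj : A ≤ Gj) (hGj : Gj.index = p ^ j)
    (hcent : ⁅(⊤ : Subgroup G), A⁆ ≤
      (⁅Gj, Gj⁆ ⊔ ⨆ I ∈ 𝓘, I ⊓ Gj) ⊔ Subgroup.closure ((fun x : G => x ^ p) '' (Gj : Set G)))
    {k : ℕ} (hk : k ≤ t) {Gk : Subgroup G} (hAGk : A ≤ Gk) (hGk : Gk.index = p ^ k) :
    ((⁅Gk, Gk⁆ ⊔ ⨆ I ∈ 𝓘, I ⊓ Gk) ⊔ Subgroup.closure ((fun x : G => x ^ p) '' (Gk : Set G))).relIndex Gk ≤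
      ((⁅Gj, Gj⁆ ⊔ ⨆ I ∈ 𝓘, I ⊓ Gj) ⊔ Subgroup.closure ((fun x : G => x ^ p) '' (Gj : Set G))).relIndex Gj := by
  classical
  set Y : Submodule ℤ (Additive A) := subOf A (⁅(⊤ : Subgroup G), ⊤⁆ ⊔ ⨆ I ∈ 𝓘, I) with hY
  set φ : Module.End ℤ (Additive A) := conjEnd A g with hφ
  set P : Submodule ℤ (Additive A) := (⊤ : Submodule ℤ (Additive A)).map ((p : ℤ) • (1 : Module.End ℤ (Additive A)))
    with hP
  have hφt : φ ^ p ^ t = 1 := conjEnd_pow_index_eq_one hgA hgen hind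
  -- `[G_i : N_i P_i] = #(A/(ν_i Y + pA))`
  have hquot : ∀ {i : ℕ} (hi : i ≤ t) {Gi : Subgroup G} (hAGi : A ≤ Gi) (hGi : Gi.index = p ^ i),
      ((⁅Gi, Gi⁆ ⊔ ⨆ I ∈ 𝓘, I ⊓ Gi) ⊔ Subgroup.closure ((fun x : G => x ^ p) '' (Gi : Set G))).relIndex Gi =
        Nat.card (Additive A ⧸ (Y.map (∑ i ∈ range (p ^ i), φ ^ i) ⊔ P)) := by
    intro i hi Gi hAGi hGi
    have hmul := relIndex_commutator_sup_layer_pow_mul_card hgA hgen hind h𝓘 hg𝓘 hi hAGi hGi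
    have hcard : Nat.card A = Nat.card ↥(Y.map (∑ i ∈ range (p ^ i), φ ^ i) ⊔ P) *
        Nat.card (Additive A ⧸ (Y.map (∑ i ∈ range (p ^ i), φ ^ i) ⊔ P)) :=
      Submodule.card_eq_card_quotient_mul_card (Y.map (∑ i ∈ range (p ^ i), φ ^ i) ⊔ P)
    rw [hcard, mul_comm (Nat.card ↥(Y.map _ ⊔ P))] at hmul
    exact Nat.eq_of_mul_eq_mul_right Nat.card_pos hmul
  -- the nilpotency-index lemma with `m = 1`
  have hle1 : (⊤ : Submodule ℤ (Additive A)).map ((φ - 1) ^ 1) ≤ Y.map (∑ i ∈ range (p ^ j), φ ^ i) ⊔ P := by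
    rw [pow_one]
    exact map_conjEnd_sub_one_le_of_commutator_le hgA hgen hind h𝓘 hg𝓘 hj hAGj hGj hcent
  have hle := FukudaSmallRank.card_quotient_le_of_map_sub_one_pow_le φ hφt Y j hpj hle1 k
  rw [← hquot hj hAGj hGj, ← hquot hk hAGk hGk] at hle
  exact hle

end Literature.NumberTheory.IwasawaTheory.FukudaGroup

end
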